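import Summits.ResolutionOfSingularities.ResolutionOfSingularities.Theorems.EquisingularLiftEquisingularLiftNatF102IdealLineBundle
import HarnessLib

/-!
# [OURS · L1 W4.5(b) · LINE (T-j)-PROOF · BRICK B4, sub-brick (B4-f)] The coordinate pair `t₀, t₁` read off an isomorphism
# `𝓘_{D₀} ≅ 𝓘_{D₁}` of the two section ideals

Crux chain w45b (cell `res-hironaka`), EL♮(3) stmt-ResolutionOfSingularities-20148, LINE (T-j)-PROOF of F-102
`Literature.AlgebraicGeometry.Resolution.GenusZeroOverCompleteDVR` (res-L1-w45b-lead-2 g3, skeleton v3 1683bb741349c142), BRICK B4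
`F102.exists_coordinate_functions`, last step (f) = pure extraction (res-L1-type-o6 g30, SPLIT v2 2026-08-27T22:11Z). OURS; NOT a statement of
any manuscript; AI-written, weaker than expert review. No `sorry`; standard axioms; DEF-FREE. `--supports stmt-ResolutionOfSingularities-20148
--as helper`.

SETTING. `s₀ : T₀ → C`, `s₁ : T₁ → C` closed immersions (in B4: the two disjoint sections of the F-102 curve), `𝓘_j = Deformation.idealModule s_j`
their ideal sheaves as `𝒪_C`-modules, `W₀`, `W₁` opens of `C` MISSED by `s₀`, `s₁` respectively (`s_j⁻¹ W_j = ∅`; in B4 `W_j = C ∖ D_j`,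
the skeleton's `sectionCompl`), and an ISOMORPHISM `u : 𝓘₀ ≅ 𝓘₁` of `𝒪_C`-modules (B4 steps (d)+(e): the lift of `x₀/x₁` from the closed fibre).

* `exists_section_toRing_eq` — over an open missed by `s`, every function is (the reading of) a section of `𝓘_s` (`𝓘_s|_W = 𝒪_W`);
  `eq_toRing_smul_of_toRing_eq_one` — there every section of `𝓘_s` is `ι(m) · 𝟙̃`.
* `map_app_section` — naturality of a morphism of modules on sections (restriction commutes with `φ.app`).
* `ker_ideal_eq_span_of_splitMono` — for `φ : 𝓘_s → 𝓘_{s'}` with a left inverse... (precisely: `ψ ≫ φ = 𝟙`), `W` missed by `s`, `𝟙̃ ∈ Γ(𝓘_s, W)`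
  reading to `1`, and an affine `V ⊆ W`: `𝓘_{s'}(V) = (ι(φ(𝟙̃))|_V)`.
* **`exists_coordinate_functions_of_iso`** — B4's conclusion VERBATIM (with `W_j` for `sectionCompl s_j`): `t₀ := ι(u(𝟙̃₀)) ∈ Γ(W₀, 𝒪_C)`,
  `t₁ := ι(u⁻¹(𝟙̃₁)) ∈ Γ(W₁, 𝒪_C)` satisfy `t₀|·t₁| = 1` on `W₀ ∩ W₁`, `𝓘_{D₁}(V) = (t₀|_V)` for affine `V ⊆ W₀`, `𝓘_{D₀}(V) = (t₁|_V)` for affine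
  `V ⊆ W₁`.

So B4 = (d) a morphism `u : 𝓘₀ → 𝓘₁` lifting the closed-fibre isomorphism (BRICK E on `𝓗om(𝓘₀, 𝓘₁)`) + (e) `u` is an isomorphism + THIS FILE.

References: R. Hartshorne, *Algebraic Geometry* (1977), II §5–§6 (invertible sheaves and Cartier divisors) [cite: Hartshorne1977]; The Stacks
Project, Tag 01WQ (effective Cartier divisors) [cite: StacksProject]. Tree: `Deformation.idealModule` (`SquareZeroExtensionObstruction`),
`HodgeTheory.toRing` (`BlochSemiregularityMapReal`), `Modules.exists_kernel_ι_app_eq` / `kernel_ι_app_injective` (`SectionsExact`).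
-/

set_option linter.dupNamespace false -- mandated namespace `Summit.<Summit>.<Problem>` of this single-conjunct summit

noncomputable section

open CategoryTheory CategoryTheory.Limits AlgebraicGeometry Opposite TopologicalSpace
open Literature.AlgebraicGeometry.Modules Literature.AlgebraicGeometry.Morphisms
open Literature.AlgebraicGeometry.Deformation Literature.AlgebraicGeometry.Motives Literature.AlgebraicGeometry.HodgeTheory

universe u

namespace Summit.ResolutionOfSingularities.ResolutionOfSingularities.Cruxes.EquisingularLiftNat.F102

variable {C : Scheme.{u}}

/-- Naturality of a morphism of `𝒪_C`-modules on sections: `φ(m)|_{W'} = φ(m|_{W'})`. [folklore] -/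
theorem map_app_section {M N : C.Modules} (φ : M ⟶ N) {W W' : C.Opens} (k : W' ⟶ W) (m : Γ(M, W)) :
    N.presheaf.map k.op (φ.app W m) = φ.app W' (M.presheaf.map k.op m) :=
  (PresheafOfModules.naturality_apply φ.val k.op m).symm

section OneSection

variable {T : Scheme.{u}} (s : T ⟶ C)

/-- Over an open `W` missed by `s` (`s⁻¹W = ∅`) the ring `Γ(T, s⁻¹W)` is trivial. [folklore] -/
theorem subsingleton_sections_preimage_of_eq_bot (W : C.Opens) (hW : s ⁻¹ᵁ W = ⊥) : Subsingleton Γ(T, s ⁻¹ᵁ W) := by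
  rw [hW]
  exact CommRingCat.subsingleton_of_isTerminal T.sheaf.isTerminalOfEmpty

/-- **`𝓘_s|_W = 𝒪_W` off the image**: over an open `W` with `s⁻¹W = ∅`, every `x ∈ Γ(W, 𝒪_C)` is the reading `ι(m)` of a (unique) section
`m ∈ Γ(W, 𝓘_s)`. [folklore] -/
theorem exists_section_toRing_eq (W : C.Opens) (hW : s ⁻¹ᵁ W = ⊥) (x : Γ(C, W)) :
    ∃ m : Γ(idealModule s, W), toRing (idealModuleι s) W m = x := by
  haveI := subsingleton_sections_preimage_of_eq_bot s W hW
  have h0 : (structureModuleMap s).app W x = 0 := by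
    change s.app W x = 0
    exact Subsingleton.elim _ _
  exact exists_kernel_ι_app_eq (structureModuleMap s) W x h0

/-- The reading `ι : Γ(W, 𝓘_s) → Γ(W, 𝒪_C)` is injective. [folklore] -/
theorem toRing_idealModuleι_injective (W : C.Opens) : Function.Injective (toRing (idealModuleι s) W) :=
  kernel_ι_app_injective (structureModuleMap s) W

/-- Over an open missed by `s`, with `𝟙̃ ∈ Γ(W, 𝓘_s)` the section reading to `1`: every `m ∈ Γ(W, 𝓘_s)` is `ι(m) · 𝟙̃`. [folklore] -/
theorem eq_toRing_smul_of_toRing_eq_one (W : C.Opens) (one : Γ(idealModule s, W)) (hone : toRing (idealModuleι s) W one = 1)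
    (m : Γ(idealModule s, W)) : m = toRing (idealModuleι s) W m • one := by
  apply toRing_idealModuleι_injective s W
  rw [toRing_smul, hone, mul_one]

/-- Restricting the unit section: `𝟙̃|_{W'}` reads to `1`. [folklore] -/
theorem toRing_map_eq_one {W W' : C.Opens} (k : W' ⟶ W) (one : Γ(idealModule s, W)) (hone : toRing (idealModuleι s) W one = 1) :
    toRing (idealModuleι s) W' ((idealModule s).presheaf.map k.op one) = 1 := by
  rw [← map_toRing, hone, map_one]

/-- The readings of sections of `𝓘_s` over `W` lie in the kernel of `s^♯ : Γ(W, 𝒪_C) → Γ(s⁻¹W, 𝒪_T)`. [folklore] -/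
theorem toRing_mem_ker_app (W : C.Opens) (m : Γ(idealModule s, W)) :
    toRing (idealModuleι s) W m ∈ RingHom.ker (s.app W).hom :=
  app_idealModuleι_eq_zero s W m

end OneSection

section TwoSections

variable {T T' : Scheme.{u}} (s : T ⟶ C) (s' : T' ⟶ C)

/-- **One chart of B4.** `φ : 𝓘_s → 𝓘_{s'}` with `ψ ≫ φ = 𝟙` (e.g. the two directions of an isomorphism), `W` an open missed by `s` with unit
section `𝟙̃ ∈ Γ(W, 𝓘_s)`, `V ⊆ W` affine: the ideal `𝓘_{s'}(V) = ker (s'^♯_V)` is generated by `ι(φ(𝟙̃))|_V`. [cite: Hartshorne1977, II Prop. 6.13]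
[OURS · L1 W4.5b · brick B4 (f)] -/
theorem ker_ideal_eq_span_of_retraction [QuasiCompact s'] (φ : idealModule s ⟶ idealModule s') (ψ : idealModule s' ⟶ idealModule s)
    (hψφ : ψ ≫ φ = 𝟙 _) (W : C.Opens) (hW : s ⁻¹ᵁ W = ⊥) (one : Γ(idealModule s, W))
    (hone : toRing (idealModuleι s) W one = 1) (V : C.affineOpens) (hV : (V : C.Opens) ≤ W) :
    s'.ker.ideal V = Ideal.span {C.presheaf.map (homOfLE hV).op (toRing (idealModuleι s') W (φ.app W one))} := by
  -- the restricted unit section and the generator on `V`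
  set oneV : Γ(idealModule s, (V : C.Opens)) := (idealModule s).presheaf.map (homOfLE hV).op one with honeV_def
  have honeV : toRing (idealModuleι s) (V : C.Opens) oneV = 1 := toRing_map_eq_one s (homOfLE hV) one hone
  have hgen : C.presheaf.map (homOfLE hV).op (toRing (idealModuleι s') W (φ.app W one)) =
      toRing (idealModuleι s') (V : C.Opens) (φ.app (V : C.Opens) oneV) := by
    rw [map_toRing, map_app_section]
  have hWV : s ⁻¹ᵁ (V : C.Opens) = ⊥ := eq_bot_iff.mpr ((Scheme.Hom.preimage_mono s hV).trans_eq hW)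
  rw [hgen, Scheme.Hom.ker_apply]
  apply le_antisymm
  · -- `b ∈ ker ⇒ b = ι(m)`, `m = φ(ψ(m))`, `ψ(m) = c · 𝟙̃`
    intro b hb
    obtain ⟨m, rfl⟩ := exists_kernel_ι_app_eq (structureModuleMap s') (V : C.Opens) b hb
    change toRing (idealModuleι s') (V : C.Opens) m ∈ _
    have hm : m = φ.app (V : C.Opens) (ψ.app (V : C.Opens) m) := by
      rw [← CategoryTheory.comp_apply, ← Scheme.Modules.Hom.comp_app, hψφ, Scheme.Modules.Hom.id_app]; rfl
    have hψm := eq_toRing_smul_of_toRing_eq_one s (V : C.Opens) oneV honeV (ψ.app (V : C.Opens) m)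
    rw [hm, hψm, Scheme.Modules.Hom.app_smul, toRing_smul]
    exact Ideal.mul_mem_left _ _ (Ideal.mem_span_singleton_self _)
  · rw [Ideal.span_le, Set.singleton_subset_iff]
    exact toRing_mem_ker_app s' (V : C.Opens) _

/-- **(B4-f) The coordinate pair from an isomorphism of the section ideals.** For closed immersions `s₀ : T₀ → C`, `s₁ : T₁ → C`, opens
`W₀`, `W₁` with `s₀⁻¹W₀ = ∅ = s₁⁻¹W₁` (in B4: `W_j = C ∖ D_j`) and an isomorphism `u : 𝓘_{s₀} ≅ 𝓘_{s₁}` of `𝒪_C`-modules: with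
`t₀ = ι(u(𝟙̃₀)) ∈ Γ(W₀, 𝒪_C)` and `t₁ = ι(u⁻¹(𝟙̃₁)) ∈ Γ(W₁, 𝒪_C)` — `t₀|·t₁| = 1` on `W₀ ∩ W₁`; `𝓘_{s₁}(V) = (t₀|_V)` for every affine `V ⊆ W₀`;
`𝓘_{s₀}(V) = (t₁|_V)` for every affine `V ⊆ W₁` — the conclusion of `F102.exists_coordinate_functions` verbatim. [cite: Hartshorne1977, II Prop. 6.13]
[OURS · L1 W4.5b · brick B4 (f)] toward `F102.exists_coordinate_functions`; NOT a statement of the manuscript. -/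
theorem exists_coordinate_functions_of_iso [QuasiCompact s] [QuasiCompact s'] (W₀ W₁ : C.Opens) (hW₀ : s ⁻¹ᵁ W₀ = ⊥) (hW₁ : s' ⁻¹ᵁ W₁ = ⊥)
    (u : idealModule s ≅ idealModule s') :
    ∃ (t₀ : Γ(C, W₀)) (t₁ : Γ(C, W₁)),
      C.presheaf.map (homOfLE (inf_le_left : W₀ ⊓ W₁ ≤ W₀)).op t₀ *
          C.presheaf.map (homOfLE (inf_le_right : W₀ ⊓ W₁ ≤ W₁)).op t₁ = 1 ∧
      (∀ V : C.affineOpens, ∀ hV : (V : C.Opens) ≤ W₀,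
          s'.ker.ideal V = Ideal.span {C.presheaf.map (homOfLE hV).op t₀}) ∧
      (∀ V : C.affineOpens, ∀ hV : (V : C.Opens) ≤ W₁,
          s.ker.ideal V = Ideal.span {C.presheaf.map (homOfLE hV).op t₁}) := by
  obtain ⟨one₀, hone₀⟩ := exists_section_toRing_eq s W₀ hW₀ 1
  obtain ⟨one₁, hone₁⟩ := exists_section_toRing_eq s' W₁ hW₁ 1
  refine ⟨toRing (idealModuleι s') W₀ (u.hom.app W₀ one₀), toRing (idealModuleι s) W₁ (u.inv.app W₁ one₁), ?_,
    fun V hV => ker_ideal_eq_span_of_retraction s s' u.hom u.inv u.inv_hom_id W₀ hW₀ one₀ hone₀ V hV,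
    fun V hV => ker_ideal_eq_span_of_retraction s' s u.inv u.hom u.hom_inv_id W₁ hW₁ one₁ hone₁ V hV⟩
  -- the product on `W = W₀ ⊓ W₁`
  set W : C.Opens := W₀ ⊓ W₁ with hWdef
  set k₀ : W ⟶ W₀ := homOfLE inf_le_left with hk₀
  set k₁ : W ⟶ W₁ := homOfLE inf_le_right with hk₁
  set a₀ : Γ(idealModule s, W) := (idealModule s).presheaf.map k₀.op one₀ with ha₀_def
  set a₁ : Γ(idealModule s', W) := (idealModule s').presheaf.map k₁.op one₁ with ha₁_def
  have ha₀ : toRing (idealModuleι s) W a₀ = 1 := toRing_map_eq_one s k₀ one₀ hone₀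
  have ha₁ : toRing (idealModuleι s') W a₁ = 1 := toRing_map_eq_one s' k₁ one₁ hone₁
  -- the two restricted functions
  have ht₀ : C.presheaf.map k₀.op (toRing (idealModuleι s') W₀ (u.hom.app W₀ one₀)) =
      toRing (idealModuleι s') W (u.hom.app W a₀) := by rw [map_toRing, map_app_section]
  have ht₁ : C.presheaf.map k₁.op (toRing (idealModuleι s) W₁ (u.inv.app W₁ one₁)) =
      toRing (idealModuleι s) W (u.inv.app W a₁) := by rw [map_toRing, map_app_section]
  rw [ht₀, ht₁]
  -- `u(a₀) = t₀| · a₁`, so `a₀ = u⁻¹(u(a₀)) = t₀| · u⁻¹(a₁)`; read in `𝒪_C`: `1 = t₀| · t₁|`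
  have h1 := eq_toRing_smul_of_toRing_eq_one s' W a₁ ha₁ (u.hom.app W a₀)
  have h2 : a₀ = u.inv.app W (u.hom.app W a₀) := by
    rw [← CategoryTheory.comp_apply, ← Scheme.Modules.Hom.comp_app, u.hom_inv_id, Scheme.Modules.Hom.id_app]; rfl
  have h3 := congrArg (toRing (idealModuleι s) W) h2
  rw [ha₀, h1, Scheme.Modules.Hom.app_smul, toRing_smul] at h3
  exact h3.symm

end TwoSections

end Summit.ResolutionOfSingularities.ResolutionOfSingularities.Cruxes.EquisingularLiftNat.F102

end
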